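import Summits.CriticalPhenomena.PercolationContinuityZ3.Theorems.Transplant.StarSchemeDefs
import HarnessLib

/-!
# v3′+F1 ENTRY-SEED STAR scheme, generic part 2 (supersedes `KNStarProcess`): the replayed state, success, validity and the scheme
# (design of record: HOME/ENTRY-SEED-STAR.md + lead ruling 13:07Z; signature HOME/prim-bschramm-p2-g2/KIT3-SIGNATURE.md)

builds on p205010 (kernel theorem, internal audit signed; external expert review pending) — nothing in this file uses p205010.
Lane `prim-bschramm`, seat `prim-bschramm-p2` (generic v3′); helper file (`--supports stmt-CriticalPhenomena-4575`).

* `stUpd` (update of the replayed state by an examination: on success the target gets the anchor `fib u_{j*}`, the wired source set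
  `cube u_{j*} δ`, the observed pattern, the onward set and the reached strips), **`replay`** (of a history), `successOf`, `stUpd_st`, `mst_eq_replay`;
* **`Valid`** — the envelope is fresh; the direction was onward at the source's examination;
  at least half of the source's strips towards the target are reached, and they carry pinned strip vertices in their strips, joined to the source's wired set by the
  source's star pattern, which consists of recorded open edges; every vertex of the source's wired set is joined to the root by recorded open
  edges; `nextPr`, **`starScheme : HSiteScheme V`**, `nextPr_eq_some`, `nextPr_of_valid`.
[cite: KozmaNitzan2024, §4 pp. 25–27 (exploration processes; (1)–(5))] [cite: GrimmettPercolation1999, §7.2]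
-/

noncomputable section

open MeasureTheory ProbabilityTheory
open scoped ENNReal Classical

namespace Summit.CriticalPhenomena.PercolationContinuityZ3.Theorems

namespace Transplant

namespace StarScheme

open Literature.Probability.Percolation Literature.Probability.LatticeModels SimpleGraph GadgetSystem ProbeHistory HSiteScheme
open KNCells (vspan mem_vspan_iff)
open KNStar (PConn)
open Literature.Probability.Percolation.KozmaNitzan (opens)

variable {V : Type*} [DecidableEq V]

namespace Sch

variable {A : Type*} (G : SimpleGraph V) [G.LocallyFinite] (S : Sch V A)

/-- The update of the replayed state by the examination along `e` reading `o` (chosen candidate `j`, if any). [folklore] -/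
def stUpd (σ : State V A S.Γ.N) (h : ProbeHistory V) (e : Site 2 × MDir) (o : Finset (Sym2 V)) : State V A S.Γ.N :=
  match S.eIdx σ e o with
  | none => ⟨σ.st.update e False, σ.anc, σ.srcs, σ.pat, σ.ons, σ.J⟩
  | some j =>
    ⟨σ.st.update e (S.succP G σ h e o),
      Function.update σ.anc (tgt e) (S.candA σ e j),
      Function.update σ.srcs (tgt e) (S.cubeOf σ e j),
      Function.update σ.pat (tgt e) o,
      Function.update σ.ons (tgt e) (S.onward G h (tgt e)),
      Function.update σ.J (tgt e) (S.reached G σ h e o j)⟩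

/-- **Replay** of a history (newest entry first). [cite: KozmaNitzan2024, §4 pp. 25–27] -/
def replay : ProbeHistory V → State V A S.Γ.N
  | [] => S.sInit G
  | none :: h => replay h
  | some r :: h =>
    match (replay h).st.choice with
    | none => replay h
    | some e => S.stUpd G (replay h) h e r.2

/-- **Success** of the probe made after `h` along `e`, reading `o`. [cite: KozmaNitzan2024, §4 p. 27] -/
def successOf (h : ProbeHistory V) (e : Site 2 × MDir) (o : Finset (Sym2 V)) : Prop := S.succP G (S.replay G h) h e o

/-- Replay of the empty history. [folklore] -/
@[simp] theorem replay_nil : S.replay G [] = S.sInit G := rfl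

/-- A `none` step does not change the replayed state. [folklore] -/
@[simp] theorem replay_cons_none (h : ProbeHistory V) : S.replay G (none :: h) = S.replay G h := rfl

/-- A recorded probe updates along the chosen edge, if any. [folklore] -/
theorem replay_cons_some (r : ProbeRecord V) (h : ProbeHistory V) :
    S.replay G (some r :: h) = (match (S.replay G h).st.choice with
      | none => S.replay G h
      | some e => S.stUpd G (S.replay G h) h e r.2) := rfl

/-- The macro part of the update is the `HState` update by success. [folklore] -/
theorem stUpd_st (σ : State V A S.Γ.N) (h : ProbeHistory V) (e : Site 2 × MDir) (o : Finset (Sym2 V)) :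
    (S.stUpd G σ h e o).st = σ.st.update e (S.succP G σ h e o) := by
  unfold stUpd
  cases hi : S.eIdx σ e o with
  | none =>
    have : ¬S.succP G σ h e o := by rintro ⟨j, hj, -⟩; rw [hi] at hj; cases hj
    simp only [HSiteScheme.HState.update, this, if_false]
  | some j => rfl

/-- **The macro-state replayed by the `HSiteScheme` machinery from `succ` is the macro part of the replay.** [folklore] -/
theorem mst_eq_replay : ∀ h : ProbeHistory V, HSiteScheme.mstOf (S.successOf G) h = (S.replay G h).st
  | [] => rfl
  | none :: h => by rw [HSiteScheme.mstOf_cons_none, replay_cons_none]; exact mst_eq_replay h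
  | some r :: h => by
    rw [HSiteScheme.mstOf_cons_some, mst_eq_replay h, replay_cons_some]
    cases (S.replay G h).st.choice with
    | none => rfl
    | some e => rw [stUpd_st]; rfl

/-- **Validity** of a history for the examination along `e`. [cite: KozmaNitzan2024, §4 p. 25 (2), p. 27] -/
structure Valid (h : ProbeHistory V) (e : Site 2 × MDir) : Prop where
  /-- the envelope is fresh -/
  fresh : Disjoint (S.env G (S.replay G h) h e) (S.F G h)
  /-- the direction was onward when the source was examined -/
  ons_mem : e.2 ∈ (S.replay G h).ons e.1
  /-- at least half of the strips of the source towards `e.2` are reached -/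
  J_card : S.Γ.N ≤ 2 * ((S.replay G h).J e.1 e.2).card
  /-- the reached strips of the source towards `e.2` are reached: a strip vertex is joined to the source's wired set by its star pattern -/
  J_spec : ∀ j ∈ (S.replay G h).J e.1 e.2, ∃ t ∈ S.Γ.strip ((S.replay G h).anc e.1) e.1 e.2 j,
    PConnS ((S.replay G h).pat e.1) ((S.replay G h).srcs e.1) t
  /-- the source's star pattern consists of recorded open edges -/
  pat_sub : (S.replay G h).pat e.1 ⊆ S.U₀ G ∪ opens h
  /-- every vertex of the source's wired set is joined to the root by recorded open edges -/
  srcs_joined : ∀ c ∈ (S.replay G h).srcs e.1, PConn (S.U₀ G ∪ opens h) S.Γ.root c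

variable {G S} in
/-- Under validity, every candidate's pinned strip vertex lies in its strip and is joined to the source's wired set by the source's star pattern.
[folklore] -/
theorem Valid.entryV_spec {h : ProbeHistory V} {e : Site 2 × MDir} (hV : S.Valid G h e) {j : Fin S.Γ.N} (hj : j ∈ (S.replay G h).J e.1 e.2) :
    S.entryV (S.replay G h) e j ∈ S.Γ.strip ((S.replay G h).anc e.1) e.1 e.2 j ∧
      PConnS ((S.replay G h).pat e.1) ((S.replay G h).srcs e.1) (S.entryV (S.replay G h) e j) :=
  S.Γ.stripPt_spec (hV.J_spec j hj)

/-- The next probe: examine the chosen candidate, but only after a valid history. [cite: KozmaNitzan2024, §4 p. 27] -/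
def nextPr (h : ProbeHistory V) : Option (AProbe V) :=
  match (S.replay G h).st.choice with
  | none => none
  | some e => if S.Valid G h e then some (S.probeP G (S.replay G h) h e) else none

/-- **The entry-seed star exploration process** as a history-driven site scheme. [cite: KozmaNitzan2024, §4 pp. 25–27] -/
def starScheme : HSiteScheme V := ⟨⟨S.nextPr G⟩, S.U₀ G, S.successOf G⟩

/-- The scheme's macro-state is the macro part of the replay. [folklore] -/
theorem starScheme_mst (h : ProbeHistory V) : (S.starScheme G).mst h = (S.replay G h).st := S.mst_eq_replay G h

/-- If a probe is made, the history is valid for the chosen edge and the probe is the staged examination. [folklore] -/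
theorem nextPr_eq_some {h : ProbeHistory V} {P : AProbe V} (hP : S.nextPr G h = some P) :
    ∃ e, (S.replay G h).st.choice = some e ∧ S.Valid G h e ∧ P = S.probeP G (S.replay G h) h e := by
  unfold nextPr at hP
  cases hc : (S.replay G h).st.choice with
  | none => rw [hc] at hP; simp at hP
  | some e =>
    rw [hc] at hP
    simp only at hP
    split_ifs at hP with hV
    rw [Option.some.injEq] at hP
    exact ⟨e, rfl, hV, hP.symm⟩

/-- Conversely a valid history with a candidate is probed. [folklore] -/
theorem nextPr_of_valid {h : ProbeHistory V} {e : Site 2 × MDir}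
    (hc : (S.replay G h).st.choice = some e) (hV : S.Valid G h e) :
    S.nextPr G h = some (S.probeP G (S.replay G h) h e) := by
  unfold nextPr; rw [hc]; simp only; rw [if_pos hV]

end Sch

end StarScheme

end Transplant

end Summit.CriticalPhenomena.PercolationContinuityZ3.Theorems

end
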